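import Mathlib
import Summits.ValiantsHypothesis.ValiantsHypothesis.Theorems.LiouvilleSarnakLiouvilleCutRankSwapStability
import Summits.ValiantsHypothesis.ValiantsHypothesis.Theorems.LiouvilleSarnakLiouvilleCutRankDefectiveWindow
import Summits.ValiantsHypothesis.ValiantsHypothesis.Theorems.LiouvilleSarnakLiouvilleCutRankOneScaleWindowEmbedding
import Summits.ValiantsHypothesis.ValiantsHypothesis.Theorems.LiouvilleSarnakLiouvilleCutRankInterleavedUnbounded
import Summits.ValiantsHypothesis.ValiantsHypothesis.Theorems.LiouvilleSarnakLiouvilleCutRankInterleavedKernel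

/-!
# Route LiouvilleSarnak — crux `LiouvilleCutRank` (stmt-ValiantsHypothesis-14775):
# DEFECTIVE WINDOWS for an ARBITRARY target pattern, and interleaved windows `(CR)^L` with `≤ d` defects

`…DefectiveWindow` repaired windows that are `R^L C^L` up to `d` wrong letters.  This file runs the same
pairing argument for an ARBITRARY balanced target pattern `T` on a window (`T k = true`: offset `k` should be
a row bit), so that every "exact window" theorem of the route becomes a "window with `≤ d` defects" theorem:

* §1 `le_rank_of_interleavedWindow` — NEW exact-window class: a window `(CR)^L` (offsets `2i` columns,
  `2i+1` rows) ANYWHERE in a cut word forces rank `≥ W` for `L ≥ L(W)` (window embedding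
  `OneScale.rank_inducedCut_le` with the standard interleaved cut + `InterleavedUnbounded.interleavedCutRank`;
  previously only the GLOBAL cut `(CR)^n` was covered).
* §2 `window_after_swaps_target`, §3 `card_rowsIn_add_card_colsIn_le` — repair and counting for a target `T`.
* §4 ★ `le_rank_of_defectiveTarget` — at one level `n`: if every cut whose window `[s, s+2L)` is EXACTLY `T`
  has rank `≥ 4^d W` (`T` balanced on the window), then every cut whose window has `≤ d` defects w.r.t. `T`
  (column bits at `T`-row offsets plus row bits at `T`-column offsets) has rank `≥ W`.
* ★ `le_rank_of_defectiveInterleavedWindow` — for all `W, d` there is `L` such that every cut with a window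
  equal to `(CR)^L` up to `d` wrong letters has rank `≥ W`.

Honest framing: robustness bookkeeping (defect budget fixed as `L → ∞`); `LiouvilleCutRank`,
`DigitalBilinearLiouville`, `AlgebraicSarnak` stay OPEN; nothing bears on `VP ≠ VNP`.  No definitions.
-/

set_option linter.dupNamespace false

noncomputable section

namespace Summit.ValiantsHypothesis.ValiantsHypothesis.Theorems.LiouvilleSarnakLiouvilleCutRank.DefectiveTarget

open ArithmeticFunction Finset

open Summit.ValiantsHypothesis.ValiantsHypothesis.Theorems.LiouvilleSarnakLiouvilleCutRank.SwapStability
  (rank_swaps_le)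
open Summit.ValiantsHypothesis.ValiantsHypothesis.Theorems.LiouvilleSarnakLiouvilleCutRank.DefectiveWindow
  (foldr_swaps_apply_inl_of_not_mem foldr_swaps_apply_inr_of_not_mem foldr_swaps_apply_of_mem)
open Summit.ValiantsHypothesis.ValiantsHypothesis.Theorems.LiouvilleSarnakLiouvilleCutRank.OneScale
  (rank_inducedCut_le)
open Summit.ValiantsHypothesis.ValiantsHypothesis.Theorems.LiouvilleSarnakLiouvilleCutRank.InterleavedUnbounded
  (interleavedCutRank)
open Summit.ValiantsHypothesis.ValiantsHypothesis.Theorems.LiouvilleSarnakLiouvilleCutRank.Interleaved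
  (exists_interleavedCut)

/-! ### §1 Exact interleaved windows -/

/-- The word of the standard interleaved cut: position `k` is a row bit iff `k` is odd. [folklore] -/
theorem isLeft_interleavedCut {L : ℕ} (π₁ : Fin L ⊕ Fin L ≃ Fin (2 * L))
    (hπ₁ : ∀ i : Fin L, (π₁ (Sum.inl i) : ℕ) = 2 * i + 1 ∧ (π₁ (Sum.inr i) : ℕ) = 2 * i)
    (k : Fin (2 * L)) : (π₁.symm k).isLeft = decide ((k : ℕ) % 2 = 1) := by
  rcases hk : π₁.symm k with i | i
  · have h1 : (k : ℕ) = 2 * i + 1 := by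
      rw [← (hπ₁ i).1, ← hk, Equiv.apply_symm_apply]
    rw [Sum.isLeft_inl, h1]
    simp [Nat.add_mod]
  · have h1 : (k : ℕ) = 2 * i := by
      rw [← (hπ₁ i).2, ← hk, Equiv.apply_symm_apply]
    rw [Sum.isLeft_inr, h1]
    simp [Nat.mul_mod_right]

/-- ★ **Interleaved windows.**  For every `W` there is `L` such that at every level `n`, every cut whose word
has a window `[s, s+2L)` with column bits at the even offsets and row bits at the odd offsets (a factor
`(CR)^L`) has Liouville cut-matrix rank `≥ W`. [this file] -/
theorem le_rank_of_interleavedWindow (W : ℕ) : ∃ L : ℕ, ∀ (n : ℕ) (π : Fin n ⊕ Fin n ≃ Fin (2 * n))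
    (s : ℕ), s + 2 * L ≤ 2 * n →
    (∀ j : Fin (2 * n), s ≤ (j : ℕ) → (j : ℕ) < s + 2 * L →
      (π.symm j).isLeft = decide (((j : ℕ) - s) % 2 = 1)) →
    W ≤ (Matrix.of fun r c : Fin n → Bool =>
      (((liouville (Nat.ofBits (fun k : Fin (2 * n) => Sum.elim r c (π.symm k)) + 1) : ℤ) :
        ℂ))).rank := by
  obtain ⟨L, hL⟩ := interleavedCutRank W
  refine ⟨L, fun n π s hs hwin => ?_⟩
  obtain ⟨π₁, hπ₁⟩ := exists_interleavedCut L
  have h1 := hL L le_rfl π₁ hπ₁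
  refine h1.trans (rank_inducedCut_le L n π (fun m => decide ((m - s) % 2 = 1)) s hs ?_ π₁ ?_)
  · intro j hj1 hj2
    rw [hwin j hj1 hj2]
  · intro k
    rw [isLeft_interleavedCut π₁ hπ₁ k]
    simp

/-! ### §2 Repairing a window towards a target pattern -/

/-- **Repaired window, general target.**  Let `T : ℕ → Bool` be the target (offset `k ↦` "row bit?") and `Lw`
a swap list with distinct row indices and distinct column indices such that every column index at a window
position with `T = true` and every row index at a window position with `T = false` is swapped, while no swapped
row index sits at a window position with `T = true` and no swapped column index at one with `T = false`.  Then
after the swaps the window reads exactly `T`. [folklore] -/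
theorem window_after_swaps_target {n : ℕ} (π : Fin n ⊕ Fin n ≃ Fin (2 * n)) (Lw : List (Fin n × Fin n))
    (h1 : (Lw.map Prod.fst).Nodup) (h2 : (Lw.map Prod.snd).Nodup) (s M : ℕ) (T : ℕ → Bool)
    (hA : ∀ j : Fin n, s ≤ (π (Sum.inr j) : ℕ) → (π (Sum.inr j) : ℕ) < s + M →
      T ((π (Sum.inr j) : ℕ) - s) = true → j ∈ Lw.map Prod.snd)
    (hB : ∀ i : Fin n, s ≤ (π (Sum.inl i) : ℕ) → (π (Sum.inl i) : ℕ) < s + M →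
      T ((π (Sum.inl i) : ℕ) - s) = false → i ∈ Lw.map Prod.fst)
    (hR : ∀ q ∈ Lw, ¬ (s ≤ (π (Sum.inl q.1) : ℕ) ∧ (π (Sum.inl q.1) : ℕ) < s + M ∧
      T ((π (Sum.inl q.1) : ℕ) - s) = true))
    (hC : ∀ q ∈ Lw, ¬ (s ≤ (π (Sum.inr q.2) : ℕ) ∧ (π (Sum.inr q.2) : ℕ) < s + M ∧
      T ((π (Sum.inr q.2) : ℕ) - s) = false)) :
    ∀ k : Fin (2 * n), s ≤ (k : ℕ) → (k : ℕ) < s + M →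
      ((Lw.foldr (fun q e => (Equiv.swap (Sum.inl q.1) (Sum.inr q.2)).trans e) π).symm k).isLeft =
        T ((k : ℕ) - s) := by
  set π₀ := Lw.foldr (fun q e => (Equiv.swap (Sum.inl q.1) (Sum.inr q.2)).trans e) π with hπ₀
  intro k hk1 hk2
  rcases hx : π₀.symm k with i | j
  · rw [Sum.isLeft_inl]
    have hk : π₀ (Sum.inl i) = k := by rw [← hx, Equiv.apply_symm_apply]
    cases hT : T ((k : ℕ) - s) with
    | true => rfl
    | false =>
      exfalso
      by_cases hi : i ∈ Lw.map Prod.fst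
      · obtain ⟨q, hq, hqi⟩ := List.mem_map.mp hi
        have hmem : (i, q.2) ∈ Lw := by rw [← hqi]; exact hq
        have h := (foldr_swaps_apply_of_mem π Lw h1 h2 i q.2 hmem).1
        rw [← hπ₀, hk] at h
        exact hC q hq ⟨by rw [← h]; exact hk1, by rw [← h]; exact hk2, by rw [← h]; exact hT⟩
      · have h := foldr_swaps_apply_inl_of_not_mem π Lw i hi
        rw [← hπ₀, hk] at h
        exact hi (hB i (by rw [← h]; exact hk1) (by rw [← h]; exact hk2) (by rw [← h]; exact hT))
  · rw [Sum.isLeft_inr]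
    have hk : π₀ (Sum.inr j) = k := by rw [← hx, Equiv.apply_symm_apply]
    cases hT : T ((k : ℕ) - s) with
    | false => rfl
    | true =>
      exfalso
      by_cases hj : j ∈ Lw.map Prod.snd
      · obtain ⟨q, hq, hqj⟩ := List.mem_map.mp hj
        have hmem : (q.1, j) ∈ Lw := by rw [← hqj]; exact hq
        have h := (foldr_swaps_apply_of_mem π Lw h1 h2 q.1 j hmem).2
        rw [← hπ₀, hk] at h
        exact hR q hq ⟨by rw [← h]; exact hk1, by rw [← h]; exact hk2, by rw [← h]; exact hT⟩
      · have h := foldr_swaps_apply_inr_of_not_mem π Lw j hj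
        rw [← hπ₀, hk] at h
        exact hj (hA j (by rw [← h]; exact hk1) (by rw [← h]; exact hk2) (by rw [← h]; exact hT))

/-! ### §3 Counting -/

/-- The row indices and the column indices sitting in a set `S` of positions number at most `#S`
together. [folklore] -/
theorem card_rowsIn_add_card_colsIn_le {n : ℕ} (π : Fin n ⊕ Fin n ≃ Fin (2 * n))
    (S : Finset (Fin (2 * n))) :
    (univ.filter fun i : Fin n => π (Sum.inl i) ∈ S).card +
      (univ.filter fun j : Fin n => π (Sum.inr j) ∈ S).card ≤ S.card := by
  classical
  rw [← card_disjSum]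
  refine card_le_card_of_injOn (fun x => π x) ?_ ?_
  · intro x hx
    rw [mem_coe, mem_disjSum] at hx
    rcases hx with ⟨i, hi, rfl⟩ | ⟨j, hj, rfl⟩
    · exact (mem_filter.mp hi).2
    · exact (mem_filter.mp hj).2
  · intro x _ y _ hxy
    exact π.injective hxy

/-- Window positions with a prescribed target letter are at most as many as the target prescribes.
[folklore] -/
theorem card_window_filter_le {n : ℕ} (s M : ℕ) (T : ℕ → Bool) (b : Bool) :
    (univ.filter fun k : Fin (2 * n) => s ≤ (k : ℕ) ∧ (k : ℕ) < s + M ∧ T ((k : ℕ) - s) = b).card ≤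
      ((range M).filter fun k => T k = b).card := by
  refine card_le_card_of_injOn (fun k => (k : ℕ) - s) ?_ ?_
  · intro k hk
    rw [mem_coe, mem_filter] at hk
    rw [mem_coe, mem_filter, mem_range]
    refine ⟨?_, hk.2.2.2⟩
    have h1 := hk.2.1
    have h2 := hk.2.2.1
    show (k : ℕ) - s < M
    omega
  · intro k hk k' hk' h
    rw [mem_coe, mem_filter] at hk hk'
    have : (k : ℕ) = k' := by
      have h' : (k : ℕ) - s = (k' : ℕ) - s := h
      omega
    exact Fin.ext this

/-! ### §4 Defective windows for an arbitrary target -/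

/-- ★ **Defective windows, arbitrary target.**  At level `n`, let `T` be a target pattern on the window
`[s, s+M)` prescribing at most `n` row offsets and at most `n` column offsets, and suppose every cut whose
window reads EXACTLY `T` has Liouville cut-matrix rank `≥ 4^d W`.  Then every cut `π` whose window has at most
`d` defects (column bits at offsets with `T = true` plus row bits at offsets with `T = false`) has rank `≥ W`:
pair the defects with each other or with opposite letters away from the conflicting positions
(`card_rowsIn_add_card_colsIn_le` guarantees partners), repair by `≤ d` swaps (`window_after_swaps_target`),
and divide by `4^d` (`SwapStability.rank_swaps_le`). [this file] -/
theorem le_rank_of_defectiveTarget {n : ℕ} (s M d W : ℕ) (T : ℕ → Bool)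
    (hTt : ((range M).filter fun k => T k = true).card ≤ n)
    (hTf : ((range M).filter fun k => T k = false).card ≤ n)
    (hbase : ∀ π' : Fin n ⊕ Fin n ≃ Fin (2 * n),
      (∀ j : Fin (2 * n), s ≤ (j : ℕ) → (j : ℕ) < s + M → (π'.symm j).isLeft = T ((j : ℕ) - s)) →
      4 ^ d * W ≤ (Matrix.of fun r c : Fin n → Bool =>
        (((liouville (Nat.ofBits (fun k : Fin (2 * n) => Sum.elim r c (π'.symm k)) + 1) : ℤ) :
          ℂ))).rank)
    (π : Fin n ⊕ Fin n ≃ Fin (2 * n))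
    (hdef : (univ.filter fun j : Fin n => s ≤ (π (Sum.inr j) : ℕ) ∧ (π (Sum.inr j) : ℕ) < s + M ∧
        T ((π (Sum.inr j) : ℕ) - s) = true).card +
      (univ.filter fun i : Fin n => s ≤ (π (Sum.inl i) : ℕ) ∧ (π (Sum.inl i) : ℕ) < s + M ∧
        T ((π (Sum.inl i) : ℕ) - s) = false).card ≤ d) :
    W ≤ (Matrix.of fun r c : Fin n → Bool =>
      (((liouville (Nat.ofBits (fun k : Fin (2 * n) => Sum.elim r c (π.symm k)) + 1) : ℤ) :
        ℂ))).rank := by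
  classical
  -- target position sets
  set St := univ.filter fun k : Fin (2 * n) => s ≤ (k : ℕ) ∧ (k : ℕ) < s + M ∧ T ((k : ℕ) - s) = true
    with hSt
  set Sf := univ.filter fun k : Fin (2 * n) => s ≤ (k : ℕ) ∧ (k : ℕ) < s + M ∧ T ((k : ℕ) - s) = false
    with hSf
  have hStn : St.card ≤ n := (card_window_filter_le s M T true).trans hTt
  have hSfn : Sf.card ≤ n := (card_window_filter_le s M T false).trans hTf
  -- defects and partners, as membership filters
  set Jdef := univ.filter fun j : Fin n => π (Sum.inr j) ∈ St with hJdef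
  set Idef := univ.filter fun i : Fin n => π (Sum.inl i) ∈ Sf with hIdef
  set Rav := univ.filter fun i : Fin n => ¬ π (Sum.inl i) ∈ St with hRav
  set Cav := univ.filter fun j : Fin n => ¬ π (Sum.inr j) ∈ Sf with hCav
  have hdef' : Jdef.card + Idef.card ≤ d := by
    have e1 : Jdef = univ.filter fun j : Fin n => s ≤ (π (Sum.inr j) : ℕ) ∧ (π (Sum.inr j) : ℕ) < s + M ∧
        T ((π (Sum.inr j) : ℕ) - s) = true := by
      rw [hJdef]; refine filter_congr fun j _ => ?_; rw [hSt, mem_filter]; simp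
    have e2 : Idef = univ.filter fun i : Fin n => s ≤ (π (Sum.inl i) : ℕ) ∧ (π (Sum.inl i) : ℕ) < s + M ∧
        T ((π (Sum.inl i) : ℕ) - s) = false := by
      rw [hIdef]; refine filter_congr fun i _ => ?_; rw [hSf, mem_filter]; simp
    rw [e1, e2]; exact hdef
  have hIR : Idef ⊆ Rav := by
    intro i hi
    rw [hIdef, mem_filter] at hi
    rw [hRav, mem_filter]
    refine ⟨mem_univ _, fun h => ?_⟩
    have h1 := (mem_filter.mp hi.2).2.2.2
    have h2 := (mem_filter.mp h).2.2.2
    rw [h1] at h2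
    exact Bool.false_ne_true h2
  have hJC : Jdef ⊆ Cav := by
    intro j hj
    rw [hJdef, mem_filter] at hj
    rw [hCav, mem_filter]
    refine ⟨mem_univ _, fun h => ?_⟩
    have h1 := (mem_filter.mp hj.2).2.2.2
    have h2 := (mem_filter.mp h).2.2.2
    rw [h1] at h2
    exact Bool.false_ne_true h2.symm
  -- counting
  have hc1 := card_rowsIn_add_card_colsIn_le π St   -- I₁.card + Jdef.card ≤ St.card
  have hc2 := card_rowsIn_add_card_colsIn_le π Sf   -- Idef.card + J₂.card ≤ Sf.card
  have hsplit1 := card_filter_add_card_filter_not (s := (univ : Finset (Fin n)))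
    (fun i : Fin n => π (Sum.inl i) ∈ St)
  have hsplit2 := card_filter_add_card_filter_not (s := (univ : Finset (Fin n)))
    (fun j : Fin n => π (Sum.inr j) ∈ Sf)
  rw [card_univ, Fintype.card_fin] at hsplit1 hsplit2
  have hRav_card : Jdef.card ≤ Rav.card := by rw [hJdef, hRav]; omega
  have hCav_card : Idef.card ≤ Cav.card := by rw [hIdef, hCav]; omega
  -- the common size of the pairing
  set m := max Jdef.card Idef.card with hm
  have hmd : m ≤ d := (max_le_add_of_nonneg (Nat.zero_le _) (Nat.zero_le _)).trans hdef'
  obtain ⟨Rs, hIRs, hRsav, hRscard⟩ :=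
    exists_subsuperset_card_eq hIR (le_max_right _ _ : Idef.card ≤ m)
      (max_le hRav_card (card_le_card hIR))
  obtain ⟨Cs, hJCs, hCsav, hCscard⟩ :=
    exists_subsuperset_card_eq hJC (le_max_left _ _ : Jdef.card ≤ m)
      (max_le (card_le_card hJC) hCav_card)
  -- the swap list
  set Lw : List (Fin n × Fin n) := Rs.toList.zip Cs.toList with hLw
  have hlen1 : Rs.toList.length = m := by rw [length_toList, hRscard]
  have hlen2 : Cs.toList.length = m := by rw [length_toList, hCscard]
  have hfst : Lw.map Prod.fst = Rs.toList := by
    rw [hLw]; exact List.map_fst_zip (by rw [hlen1, hlen2])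
  have hsnd : Lw.map Prod.snd = Cs.toList := by
    rw [hLw]; exact List.map_snd_zip (by rw [hlen1, hlen2])
  have h1 : (Lw.map Prod.fst).Nodup := by rw [hfst]; exact nodup_toList _
  have h2 : (Lw.map Prod.snd).Nodup := by rw [hsnd]; exact nodup_toList _
  have hlen : Lw.length ≤ d := by
    rw [hLw, List.length_zip, hlen1, hlen2, min_self]; exact hmd
  -- hypotheses of `window_after_swaps_target`
  have hA : ∀ j : Fin n, s ≤ (π (Sum.inr j) : ℕ) → (π (Sum.inr j) : ℕ) < s + M →
      T ((π (Sum.inr j) : ℕ) - s) = true → j ∈ Lw.map Prod.snd := by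
    intro j hj1 hj2 hj3
    rw [hsnd, mem_toList]
    refine hJCs ?_
    rw [hJdef, mem_filter, hSt, mem_filter]
    exact ⟨mem_univ _, mem_univ _, hj1, hj2, hj3⟩
  have hB : ∀ i : Fin n, s ≤ (π (Sum.inl i) : ℕ) → (π (Sum.inl i) : ℕ) < s + M →
      T ((π (Sum.inl i) : ℕ) - s) = false → i ∈ Lw.map Prod.fst := by
    intro i hi1 hi2 hi3
    rw [hfst, mem_toList]
    refine hIRs ?_
    rw [hIdef, mem_filter, hSf, mem_filter]
    exact ⟨mem_univ _, mem_univ _, hi1, hi2, hi3⟩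
  have hR : ∀ q ∈ Lw, ¬ (s ≤ (π (Sum.inl q.1) : ℕ) ∧ (π (Sum.inl q.1) : ℕ) < s + M ∧
      T ((π (Sum.inl q.1) : ℕ) - s) = true) := by
    intro q hq h
    have hq1 : q.1 ∈ Rs := by
      have := (List.of_mem_zip (by rw [← hLw]; exact hq)).1
      rwa [mem_toList] at this
    have := hRsav hq1
    rw [hRav, mem_filter] at this
    exact this.2 (by rw [hSt, mem_filter]; exact ⟨mem_univ _, h⟩)
  have hC : ∀ q ∈ Lw, ¬ (s ≤ (π (Sum.inr q.2) : ℕ) ∧ (π (Sum.inr q.2) : ℕ) < s + M ∧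
      T ((π (Sum.inr q.2) : ℕ) - s) = false) := by
    intro q hq h
    have hq2 : q.2 ∈ Cs := by
      have := (List.of_mem_zip (by rw [← hLw]; exact hq)).2
      rwa [mem_toList] at this
    have := hCsav hq2
    rw [hCav, mem_filter] at this
    exact this.2 (by rw [hSf, mem_filter]; exact ⟨mem_univ _, h⟩)
  have hwin := window_after_swaps_target π Lw h1 h2 s M T hA hB hR hC
  -- the repaired cut reads exactly `T`: rank ≥ 4^d W
  have hbig := hbase (Lw.foldr (fun q e => (Equiv.swap (Sum.inl q.1) (Sum.inr q.2)).trans e) π) hwin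
  have hle := rank_swaps_le
    (fun v : Fin (2 * n) → Bool => (((liouville (Nat.ofBits v + 1)) : ℤ) : ℂ)) π Lw
  have h3 : 4 ^ Lw.length ≤ 4 ^ d := Nat.pow_le_pow_right (by norm_num) hlen
  exact Nat.le_of_mul_le_mul_left (hbig.trans (hle.trans (Nat.mul_le_mul_right _ h3)))
    (by positivity)

/-! ### §5 Interleaved windows with defects -/

/-- Among `k < 2L`, at most `L` are odd and at most `L` are even. [folklore] -/
theorem card_range_filter_mod_two_le (L : ℕ) (b : Bool) :
    ((range (2 * L)).filter fun k => decide (k % 2 = 1) = b).card ≤ L := by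
  have hsub : ((range (2 * L)).filter fun k => decide (k % 2 = 1) = b) ⊆
      (range L).image fun i => 2 * i + (if b then 1 else 0) := by
    intro k hk
    rw [mem_filter, mem_range] at hk
    rw [mem_image]
    refine ⟨k / 2, mem_range.mpr (by omega), ?_⟩
    cases b
    · simp only [decide_eq_false_iff_not] at hk
      simp only [Bool.false_eq_true, ite_false]
      omega
    · simp only [decide_eq_true_eq] at hk
      simp only [ite_true]
      omega
  exact (card_le_card hsub).trans (card_image_le.trans (by rw [card_range]))

/-- ★ **`(CR)^L` up to `d` wrong letters.**  For all `W, d` there is `L` such that at every level `n`, every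
cut with a window `[s, s+2L)` carrying at most `d` defects with respect to the interleaved pattern (column
bits at even offsets, row bits at odd offsets) — i.e. at most `d` column bits at odd offsets plus row bits at
even offsets — has Liouville cut-matrix rank `≥ W`. [this file] -/
theorem le_rank_of_defectiveInterleavedWindow (W d : ℕ) : ∃ L : ℕ, ∀ (n : ℕ)
    (π : Fin n ⊕ Fin n ≃ Fin (2 * n)) (s : ℕ), s + 2 * L ≤ 2 * n →
    (univ.filter fun j : Fin n => s ≤ (π (Sum.inr j) : ℕ) ∧ (π (Sum.inr j) : ℕ) < s + 2 * L ∧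
        decide (((π (Sum.inr j) : ℕ) - s) % 2 = 1) = true).card +
      (univ.filter fun i : Fin n => s ≤ (π (Sum.inl i) : ℕ) ∧ (π (Sum.inl i) : ℕ) < s + 2 * L ∧
        decide (((π (Sum.inl i) : ℕ) - s) % 2 = 1) = false).card ≤ d →
    W ≤ (Matrix.of fun r c : Fin n → Bool =>
      (((liouville (Nat.ofBits (fun k : Fin (2 * n) => Sum.elim r c (π.symm k)) + 1) : ℤ) :
        ℂ))).rank := by
  obtain ⟨L, hL⟩ := le_rank_of_interleavedWindow (4 ^ d * W)
  refine ⟨L, fun n π s hs hdef => ?_⟩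
  have hLn : L ≤ n := by omega
  exact le_rank_of_defectiveTarget s (2 * L) d W (fun k => decide (k % 2 = 1))
    ((card_range_filter_mod_two_le L true).trans hLn)
    ((card_range_filter_mod_two_le L false).trans hLn)
    (fun π' hπ' => hL n π' s hs hπ') π hdef

end Summit.ValiantsHypothesis.ValiantsHypothesis.Theorems.LiouvilleSarnakLiouvilleCutRank.DefectiveTarget

end
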